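import Literature.AlgebraicGeometry.Frobenioids.BaseDegSquare
import HarnessLib

/-!
# Frobenioids I, Corollary 4.12 — "composing diagrams": the square over `F_{0_{D_i}} = D_i × N_{≥1}` from a
# tower `C_i → U_i ⥲ D_i × N_{≥1}`

Mochizuki, *The geometry of Frobenioids I: the general theory*, Kyushu J. Math. **62** (2008)
293–400, kurims text proof of Cor. 4.12 p. 95: "the natural projection functors `C_i → F_{0_{D_i}}` may
be identified with the natural functors `C_i → C_i^birat → (C_i^birat)^un-tr` [cf. Proposition 3.11, (i)]
… Corollary 4.12 follows by applying Corollary 4.10 to pass from `C_i` to `C_i^birat` …, followed by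
Theorem 3.4, (iv) …, which allows us to pass from `C_i^birat` to `(C_i^birat)^un-tr`"
[cite: MochizukiFrdI2008, Cor. 4.12 p.95].

PROOF-ONLY companion of `DivisorMonoidCategoryTheoreticity.lean` (seat abc-iut-L1-t3), generic over
`S_i : PreFrobenioidData C_i D_i`. The tower `C_i → C_i^birat → (C_i^birat)^un-tr` is abstracted as
functors `T_i : C_i ⥤ U_i` with operations `SU_i` on `U_i` over `D_i` such that `T_i ⋙ SU_i.toBaseDeg ≅
S_i.toBaseDeg` and `SU_i.toBaseDeg : U_i ⥤ D_i × N_{≥1}` is an EQUIVALENCE (Prop. 3.11 (i) for the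
Frobenioids `(C_i^birat)^un-tr` of isotropic, unit-trivial and group-like type), together with an equivalence
`Ψ^U : U₁ ⥲ U₂` `1`-commuting with `Ψ` over the `T_i` (Cor. 4.10 + Thm. 3.4 (iv)):

* `exists_toBaseDeg_equivalence_of_tower`: then `Ψ⁰ := (SU₁.toBaseDeg)⁻¹ ⋙ Ψ^U ⋙ SU₂.toBaseDeg` is an
  equivalence `D₁ × N_{≥1} ⥲ D₂ × N_{≥1}` `1`-commuting with `Ψ` over the projections `C_i → D_i × N_{≥1}`;
* `cor412_of_tower`: hence — with the `1`-uniqueness transfer of `BaseDegSquare.lean` under Def. 1.3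
  (i)(a)(b)(c), (ii), (iv)(b) of `C₁ → D₁` and the rigidity of `Base₂ ∘ Ψ` on slim bases (Prop. 1.13 (i)) —
  the typed Cor. 4.12.

No statement of the paper is strengthened; nothing here is specific to the abc programme.
-/

namespace Literature.AlgebraicGeometry.Frobenioids

open CategoryTheory Opposite

universe w₁ w₂ w₃ w₄ v₁ v₁' v₂ v₂' v₃ v₄ u₁ u₁' u₂ u₂' u₃ u₄

namespace PreFrobenioidData

section Tower

variable {C₁ : Type u₁} [Category.{v₁} C₁] {D₁ : Type u₁'} [Category.{v₁'} D₁]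
variable {C₂ : Type u₂} [Category.{v₂} C₂] {D₂ : Type u₂'} [Category.{v₂'} D₂]
variable {U₁ : Type u₃} [Category.{v₃} U₁] {U₂ : Type u₄} [Category.{v₄} U₂]
variable (S₁ : PreFrobenioidData.{w₁} C₁ D₁) (S₂ : PreFrobenioidData.{w₂} C₂ D₂) (Ψ : C₁ ≌ C₂)
variable (SU₁ : PreFrobenioidData.{w₃} U₁ D₁) (SU₂ : PreFrobenioidData.{w₄} U₂ D₂)

/-- "Composing diagrams" for Cor. 4.12 (FrdI p. 95): if `C_i → D_i × N_{≥1}` factors as `C_i → U_i` followed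
by an EQUIVALENCE `U_i ⥲ D_i × N_{≥1}` (print: `C_i → C_i^birat → (C_i^birat)^un-tr ⥲ F_{0_{D_i}}`,
Prop. 3.11 (i)), and `Ψ` induces an equivalence `Ψ^U : U₁ ⥲ U₂` over the `T_i` (print: Cor. 4.10 and
Thm. 3.4 (iv)), then `Ψ⁰ := (U₁ → D₁ × N_{≥1})⁻¹ ⋙ Ψ^U ⋙ (U₂ → D₂ × N_{≥1})` is an equivalence
`1`-commuting with `Ψ` over the projections. [cite: MochizukiFrdI2008, Cor. 4.12 p.95] -/
theorem exists_toBaseDeg_equivalence_of_tower (T₁ : C₁ ⥤ U₁) (T₂ : C₂ ⥤ U₂)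
    (ι₁ : T₁ ⋙ SU₁.toBaseDeg ≅ S₁.toBaseDeg) (ι₂ : T₂ ⋙ SU₂.toBaseDeg ≅ S₂.toBaseDeg)
    [SU₁.toBaseDeg.IsEquivalence] [SU₂.toBaseDeg.IsEquivalence]
    (ΨU : U₁ ≌ U₂) (hT : OneCommutes Ψ.functor T₂ T₁ ΨU.functor) :
    ∃ Ψ0 : D₁ × SingleObj ℕ+ ⥤ D₂ × SingleObj ℕ+,
      Ψ0.IsEquivalence ∧ OneCommutes Ψ.functor S₂.toBaseDeg S₁.toBaseDeg Ψ0 := by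
  obtain ⟨τ⟩ := hT
  let V₁ := SU₁.toBaseDeg.asEquivalence
  refine ⟨V₁.inverse ⋙ ΨU.functor ⋙ SU₂.toBaseDeg, inferInstance, ⟨?_⟩⟩
  -- `Ψ ⋙ (C₂ → D₂ × N) ≅ T₁ ⋙ Ψ^U ⋙ (U₂ → D₂ × N)`
  have e₁ : Ψ.functor ⋙ S₂.toBaseDeg ≅ T₁ ⋙ ΨU.functor ⋙ SU₂.toBaseDeg :=
    Functor.isoWhiskerLeft Ψ.functor ι₂.symm ≪≫ (Functor.associator _ _ _).symm ≪≫
      Functor.isoWhiskerRight τ SU₂.toBaseDeg ≪≫ Functor.associator _ _ _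
  -- `(C₁ → D₁ × N) ⋙ Ψ⁰ ≅ T₁ ⋙ Ψ^U ⋙ (U₂ → D₂ × N)`
  have e₂ : S₁.toBaseDeg ⋙ (V₁.inverse ⋙ ΨU.functor ⋙ SU₂.toBaseDeg) ≅ T₁ ⋙ ΨU.functor ⋙ SU₂.toBaseDeg :=
    Functor.isoWhiskerRight ι₁.symm _ ≪≫ Functor.associator _ _ _ ≪≫
      Functor.isoWhiskerLeft T₁ ((Functor.associator _ _ _).symm ≪≫
        Functor.isoWhiskerRight V₁.unitIso.symm _ ≪≫ Functor.leftUnitor _)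
  exact e₁ ≪≫ e₂.symm

/-- **Corollary 4.12 from the tower** (FrdI proof of Cor. 4.12 p. 95): under Def. 1.3 (i)(a)(b)(c), (ii),
(iv)(b) of `C₁ → D₁` (operations form), a tower `C_i → U_i ⥲ D_i × N_{≥1}` factoring the projections with an
equivalence `Ψ^U : U₁ ⥲ U₂` over `Ψ` (print: `C_i → C_i^birat → (C_i^birat)^un-tr`, Cor. 4.10, Thm. 3.4
(iv), Prop. 3.11 (i)), and the rigidity of `Base₂ ∘ Ψ` on slim bases (Prop. 1.13 (i)) give the typed
Cor. 4.12. [cite: MochizukiFrdI2008, Cor. 4.12 p.95] -/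
theorem cor412_of_tower (R₁ : S₁.RSParams) (R₂ : S₂.RSParams)
    (hbase : ∀ X : D₁, ∃ A : C₁, Nonempty (S₁.base.obj A ≅ X))
    (hconn : ∀ (A B : C₁) (g : S₁.base.obj A ≅ S₁.base.obj B), ∃ (X : C₁) (φ : X ⟶ A) (ψ : X ⟶ B),
      IsIso (S₁.base.map φ) ∧ S₁.degFr φ = 1 ∧ S₁.degFr ψ = 1 ∧ S₁.base.map φ ≫ g.hom = S₁.base.map ψ)
    (hpb : ∀ (A : C₁) {Y : D₁} (f : Y ⟶ S₁.base.obj A),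
      ∃ (A' : C₁) (φ : A' ⟶ A) (e : S₁.base.obj A' ≅ Y), S₁.base.map φ = e.hom ≫ f ∧ S₁.degFr φ = 1)
    (hfrob : ∀ (A : C₁) (n : ℕ+), ∃ (B : C₁) (γ : A ⟶ B), IsIso (S₁.base.map γ) ∧ S₁.degFr γ = n)
    (T₁ : C₁ ⥤ U₁) (T₂ : C₂ ⥤ U₂) (ι₁ : T₁ ⋙ SU₁.toBaseDeg ≅ S₁.toBaseDeg)
    (ι₂ : T₂ ⋙ SU₂.toBaseDeg ≅ S₂.toBaseDeg) [SU₁.toBaseDeg.IsEquivalence] [SU₂.toBaseDeg.IsEquivalence]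
    (ΨU : U₁ ≌ U₂) (hT : OneCommutes Ψ.functor T₂ T₁ ΨU.functor)
    (hrig : IsSlim D₁ → IsSlim D₂ → IsRigidFunctor (Ψ.functor ⋙ S₂.base)) : Cor412 S₁ S₂ Ψ R₁ R₂ :=
  cor412_of_exists_toBaseDeg_equivalence S₁ S₂ Ψ R₁ R₂ hbase hconn hpb hfrob
    (exists_toBaseDeg_equivalence_of_tower S₁ S₂ Ψ SU₁ SU₂ T₁ T₂ ι₁ ι₂ ΨU hT) hrig

end Tower

end PreFrobenioidData

end Literature.AlgebraicGeometry.Frobenioids
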